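import Summits.QuantumFields.YangMills.Theorems.UnitScaleTiltProp7SectET3NormH1
import Summits.QuantumFields.YangMills.Theorems.UnitScaleTiltProp7SectET3ClassTransfer
import HarnessLib

/-!
# Route `UnitScaleTilt`, crux «MinimiserStabilityRegPr» (stmt-QuantumFields-19200, EX) ∕ deciding crux 20520 — item I-07 of `pub/ym-inputs/INPUT-LIST.md`:
# **THE `norm_G` ∕ `norm_H₁` ROWS AT THE T³ MEMBER OF RECORD WITH THE CLASS-TRANSFER INPUT DISCHARGED** — ★w1-20520's `normG_row_of_t313_classTransfer` ∕
# `normH₁_row_of_t312_classTransfer` RE-PLUMBED on the print-faithful row `Prop7SectET3ClassTransfer.reg335_reg336_T3_of_regPr` ([Balaban1985RegularSpaces] Prop. 6),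
# so that the displayed EX rows follow from the [B9] §3 leaves + pins ALONE, at every leaf constant `c35` above a threshold

Cell `ym-inputs` (desk ym-inputs-plan-1, seat ym-inputs-p06), HUMAN RULING D-0037: YM₃ on T³ is ladder rung R3 — NOT the Clay problem.  Count-neutral helper
(`--supports stmt-QuantumFields-20520 --as helper`); THEOREMS ONLY (0 `def`, 0 `sorry`); nothing of [Balaban1985RegularSpaces] ∕ [Balaban1985BackgroundPropagators] is asserted;
★w1-20520's files are CONSUMED BY NAME (`Prop7SectET3NormG.normG_of_thm313Printed`, `Prop7SectET3NormH1.normH_of_thm312Printed`), not modified.  An OFFER to the OWNER ∕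
the EX-knit ruler: the `hCT : ClassTransferT3 ℓ hL c35` binder of the N06 readings (flag (F1): typed ∀ α₀, unsupplied by print) can be replaced, with the displayed
conclusion UNCHANGED, by nothing more than «the leaf constant `c35` is at least the Proposition-6 threshold `c35₀(L)`» — or kept as the weaker displayed hypothesis
`∃ a₅ > 0, …` of §1 (the proposed (BG-336)′), which `reg335_reg336_T3_of_regPr` discharges.

WHAT IS PROVED.
* §1 `row_of_classBound_of_regPrTransfer` — the common 12-line tail: a leaf-side bound «`∀ i`, `M₄ ≤ M` → `∀ α₀ > 0`, `M·α₀ ≤ a₀` → `∀ U ∈ (3.35) ∩ (3.36)`, `‖Op i U f‖ ≤ B₀‖f‖`»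
  and a class-transfer row in print's regime «`M·α₀ ≤ a₅` → `RegPr α₀ ⊂ (3.35) ∩ (3.36)`» give the displayed row with `a₀ := min a₀ a₅` (`RegPr e ⊂ RegPr α`, `regPr_mono`).
* §2 ★ `normG_row_of_t313_classTransferS` ∕ ★ `normH₁_row_of_t312_classTransferS` — ★w1's two base theorems with `hCT` REPLACED by the ∃-shape
  `hCTS : ∃ a₅ > 0, ∀ member, ∀ α₀ > 0, M·α₀ ≤ a₅ → ∀ U₀, RegPr … α₀ U₀ → Reg335 c35 α₀ ∧ Reg336 c35 α₀` (the body of (BG-336)′); conclusions VERBATIM those of the originals.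
* §3 ★★ `normG_row_of_t313_P6` ∕ ★★ `normH₁_row_of_t312_P6` — the class-transfer input DISCHARGED: for odd `L = ℓ + 1 ≥ 5` there is `c35₀ > 0` such that for every leaf constant
  `c35 ≥ c35₀`, `Thm313Printed c35 …` (resp. `Thm312Printed (2+1) c35 …`) + the pins give the displayed `norm_G` (resp. `norm_H₁`∕`norm_H`) row — [B8] Prop. 6 supplied by
  `reg335_reg336_T3_of_regPr` (∀ c ≥ c35₀).  The leaves are MONOTONE-COMPATIBLE: `Thm313Printed` at a larger `c35` quantifies over a larger background class, so displaying the
  leaf rows at `c35 := max (c35_leaf) c35₀` costs nothing on the N06 side (the OWNER's `c35 := max` convention, LOCATE memo ASK 1).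
HONEST SCOPE.  Re-plumbing only; the leaves (`Thm313Printed`, `Thm312Printed` — N06(d = 3), XL) and the pins stay displayed hypotheses exactly as in ★w1's files; nothing here
discharges N06, proves EX, the crux, V3∕R3, d = 4 or the mass gap.

References: T. Bałaban, CMP **99** (1985) 75–102 [Balaban1985RegularSpaces] ((1.33) p.82, Prop. 6 p.99); CMP **99** (1985) 389–434 [Balaban1985BackgroundPropagators]
(Thm 3.12 p.423, Thm 3.13 p.426, (3.47) p.398, (3.133) p.422); CMP **102** (1985) 277–309 [Balaban1985Variational] ((103) p.293, (117) p.295, (14) p.280).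
-/

set_option autoImplicit false

noncomputable section

open scoped Matrix.Norms.L2Operator

namespace Summit.QuantumFields.YangMills.Theorems.Prop7SectET3ClassTransferRows

open Literature.MathematicalPhysics.QuantumFieldTheory.Balaban1983to89
open Literature.MathematicalPhysics.QuantumFieldTheory.Balaban1983to89.T3ContinuumYM3Torus
open Literature.MathematicalPhysics.QuantumFieldTheory.Balaban1983to89.T3PrintedRegularMinimiser (RegPr)
open Literature.MathematicalPhysics.QuantumFieldTheory.Balaban1983to89.T3PrintedMinimiserExistence (regPr_mono)
open Literature.MathematicalPhysics.QuantumFieldTheory.Balaban1983to89.B6KLevelCensusIndexV1 (KIdx kGeo)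
open Literature.MathematicalPhysics.QuantumFieldTheory.Balaban1983to89.B6GlobalChartV1 (PV)
open Literature.MathematicalPhysics.QuantumFieldTheory.Balaban1983to89.B9GeoNormsKLevelV1 (geo9K)
open Literature.MathematicalPhysics.QuantumFieldTheory.Balaban1983to89.B9GeoLemma21KLevelV1 (rowSum261_geo9K)
open Summit.QuantumFields.YangMills.Theorems.Prop7SectET3Members (hd3 memberIdx)
open Summit.QuantumFields.YangMills.Theorems.Prop7SectET3BgClass (bgT3 cfgV1OfT3)
open Summit.QuantumFields.YangMills.Theorems.Prop7SectET3Geometry (geoOK_geo9K)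
open Summit.QuantumFields.YangMills.Theorems.Prop7SectET3NormG (geo9K_M_memberIdx normG_of_thm313Printed)
open Summit.QuantumFields.YangMills.Theorems.Prop7SectET3NormH1 (normH_of_thm312Printed)
open Summit.QuantumFields.YangMills.Theorems.Prop7SectET3ClassTransfer (reg335_reg336_T3_of_regPr)

variable {ℓ : ℕ} {hL : Odd (ℓ + 1) ∧ 1 < ℓ + 1} {c35 : ℝ}

/-! ## §1 The common tail: leaf-side class bound + class-transfer row in print's regime ⟹ the displayed row -/

/-- **THE RE-PLUMBING** (the tail of ★w1-20520's `normG_row_of_t313_classTransfer`, with the class-transfer row read in print's regime): a bound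
`‖Op i U f‖ ≤ B₀‖f‖` for the members above `M₄` and the backgrounds in (3.35) ∩ (3.36) at every `α₀` with `M·α₀ ≤ a₀`, together with «`M·α₀ ≤ a₅` ⟹ `RegPr α₀ ⊂ (3.35) ∩ (3.36)`»
at the members of record, gives the displayed row `RegPr … e U₀ → e ≤ (min a₀ a₅)∕(L·L^{a'}) → ‖Op (memberIdx …) (cfgV1OfT3 U₀) f‖ ≤ B₀‖f‖` (`RegPr e ⊂ RegPr α`, `α = min a₀ a₅ ∕ M`).
[cite: Balaban1985Variational, (14) p.280, (117) p.295; Balaban1985RegularSpaces, (1.33) p.82] -/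
theorem row_of_classBound_of_regPrTransfer {X Y : ∀ i : KIdx 2 ℓ hd3 hL 1 1, (bgT3 i).Cfg → Type} [∀ i U, SeminormedAddCommGroup (X i U)]
    [∀ i U, SeminormedAddCommGroup (Y i U)] (Op : ∀ (i : KIdx 2 ℓ hd3 hL 1 1) (U : (bgT3 i).Cfg), X i U → Y i U) {M₄ a₀ B₀ a₅ : ℝ} (ha₀ : 0 < a₀) (ha₅ : 0 < a₅)
    (h : ∀ i : KIdx 2 ℓ hd3 hL 1 1, M₄ ≤ (geo9K i).M → ∀ α₀ : ℝ, 0 < α₀ → (geo9K i).M * α₀ ≤ a₀ →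
      ∀ U : (bgT3 i).Cfg, (bgT3 i).Reg335 c35 α₀ U → (bgT3 i).Reg336 c35 α₀ U → ∀ f : X i U, ‖Op i U f‖ ≤ B₀ * ‖f‖)
    (hrow : ∀ (hℓ : 4 ≤ ℓ) (m : ℕ) (hm : 1 ≤ m) (n K a' R : ℕ) (hk1 : 1 ≤ K - n) (hsize : a' + 3 ≤ m + n) (hM8 : 8 ≤ (ℓ + 1) ^ a')
      (hR2 : 2 * (ℓ + 1) ^ 2 ≤ R) (α₀ : ℝ), 0 < α₀ → ((ℓ + 1 : ℕ) : ℝ) * (((ℓ + 1) ^ a' : ℕ) : ℝ) * α₀ ≤ a₅ →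
      ∀ U₀ : GaugeField (PV 2 ℓ m K hd3 hL) 0 (Matrix.specialUnitaryGroup (Fin 2) ℂ), RegPr (⟨ℓ + 1, hL, m, hm⟩ : T3Family) n K α₀ U₀ →
        (bgT3 (memberIdx ℓ hL hℓ m hm n K a' R hk1 hsize hM8 hR2)).Reg335 c35 α₀ (cfgV1OfT3 U₀) ∧
          (bgT3 (memberIdx ℓ hL hℓ m hm n K a' R hk1 hsize hM8 hR2)).Reg336 c35 α₀ (cfgV1OfT3 U₀))
    (hℓ : 4 ≤ ℓ) (m : ℕ) (hm : 1 ≤ m) (n K a' R : ℕ) (hk1 : 1 ≤ K - n) (hsize : a' + 3 ≤ m + n) (hM8 : 8 ≤ (ℓ + 1) ^ a') (hR2 : 2 * (ℓ + 1) ^ 2 ≤ R)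
    (hM : M₄ ≤ ((ℓ + 1 : ℕ) : ℝ) * (((ℓ + 1) ^ a' : ℕ) : ℝ)) (e : ℝ) (U₀ : GaugeField (PV 2 ℓ m K hd3 hL) 0 (Matrix.specialUnitaryGroup (Fin 2) ℂ))
    (hreg : RegPr (⟨ℓ + 1, hL, m, hm⟩ : T3Family) n K e U₀) (he : e ≤ min a₀ a₅ / (((ℓ + 1 : ℕ) : ℝ) * (((ℓ + 1) ^ a' : ℕ) : ℝ)))
    (f : X (memberIdx ℓ hL hℓ m hm n K a' R hk1 hsize hM8 hR2) (cfgV1OfT3 U₀)) :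
    ‖Op (memberIdx ℓ hL hℓ m hm n K a' R hk1 hsize hM8 hR2) (cfgV1OfT3 U₀) f‖ ≤ B₀ * ‖f‖ := by
  set i := memberIdx ℓ hL hℓ m hm n K a' R hk1 hsize hM8 hR2 with hi
  have hMpos : 0 < ((ℓ + 1 : ℕ) : ℝ) * (((ℓ + 1) ^ a' : ℕ) : ℝ) := by positivity
  -- the member-uniform radius `α = min a₀ a₅ / M`
  set α : ℝ := min a₀ a₅ / (((ℓ + 1 : ℕ) : ℝ) * (((ℓ + 1) ^ a' : ℕ) : ℝ)) with hα
  have hαpos : 0 < α := div_pos (lt_min ha₀ ha₅) hMpos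
  have hMαeq : ((ℓ + 1 : ℕ) : ℝ) * (((ℓ + 1) ^ a' : ℕ) : ℝ) * α = min a₀ a₅ := by
    rw [hα, mul_div_cancel₀ _ hMpos.ne']
  have hreg' : RegPr (⟨ℓ + 1, hL, m, hm⟩ : T3Family) n K α U₀ := regPr_mono _ he hreg
  have hcls := hrow hℓ m hm n K a' R hk1 hsize hM8 hR2 α hαpos (by rw [hMαeq]; exact min_le_right _ _) U₀ hreg'
  have hMα : (geo9K i).M * α ≤ a₀ := by
    rw [hi, geo9K_M_memberIdx, hMαeq]
    exact min_le_left _ _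
  exact h i (by rw [hi, geo9K_M_memberIdx]; exact hM) α hαpos hMα (cfgV1OfT3 U₀) hcls.1 hcls.2 f

/-! ## §2 ★w1-20520's two base rows with `hCT` replaced by the print-faithful shape (BG-336)′ -/

section Shape

variable {GG : ∀ i : KIdx 2 ℓ hd3 hL 1 1, B9.KernelFamily (geo9K i) (bgT3 i)}
  {GD G₁ : ∀ i : KIdx 2 ℓ hd3 hL 1 1, B9.KernelFamily (geo9K i) (bgT3 i)} {Hk H₁k : ∀ i : KIdx 2 ℓ hd3 hL 1 1, B9.HKernel (geo9K i) (bgT3 i)}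
  {HasRWExp : ∀ i : KIdx 2 ℓ hd3 hL 1 1, B9.KernelFamily (geo9K i) (bgT3 i) → (bgT3 i).Cfg → ℝ → Prop}
  {HasRWExpH : ∀ i : KIdx 2 ℓ hd3 hL 1 1, B9.HKernel (geo9K i) (bgT3 i) → (bgT3 i).Cfg → ℝ → Prop}
  {PosDefK : ∀ i : KIdx 2 ℓ hd3 hL 1 1, B9.KernelFamily (geo9K i) (bgT3 i) → (bgT3 i).Cfg → Prop}

/-- ★ **THE DISPLAYED `norm_G` ROW FROM `Thm313Printed` ∧ (BG-336)′ ∧ THE TWO (3.47) PINS** — ★w1-20520's `normG_row_of_t313_classTransfer` with `hCT : ClassTransferT3 ℓ hL c35` (∀ α₀)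
replaced by the print-faithful ∃-shape `hCTS` (the body of the re-typed row proposed in `pub/ym-inputs/CLASS-TRANSFER-LOCATE-p06.md`, discharged by
`Prop7SectET3ClassTransfer.reg335_reg336_T3_of_regPr` for `c35` above its threshold); conclusion VERBATIM.
[cite: Balaban1985Variational, (117) p.295, (14) p.280; Balaban1985BackgroundPropagators, Thm 3.13 p.426, (3.47) p.398; Balaban1985RegularSpaces, (1.33) p.82, Prop. 6 p.99] -/
theorem normG_row_of_t313_classTransferS (h313 : B9.Thm313Printed c35 geo9K bgT3 GG HasRWExp PosDefK)
    (hCTS : ∃ a₅ : ℝ, 0 < a₅ ∧ ∀ (hℓ : 4 ≤ ℓ) (m : ℕ) (hm : 1 ≤ m) (n K a' R : ℕ) (hk1 : 1 ≤ K - n) (hsize : a' + 3 ≤ m + n) (hM8 : 8 ≤ (ℓ + 1) ^ a')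
      (hR2 : 2 * (ℓ + 1) ^ 2 ≤ R) (α₀ : ℝ), 0 < α₀ → ((ℓ + 1 : ℕ) : ℝ) * (((ℓ + 1) ^ a' : ℕ) : ℝ) * α₀ ≤ a₅ →
      ∀ U₀ : GaugeField (PV 2 ℓ m K hd3 hL) 0 (Matrix.specialUnitaryGroup (Fin 2) ℂ), RegPr (⟨ℓ + 1, hL, m, hm⟩ : T3Family) n K α₀ U₀ →
        (bgT3 (memberIdx ℓ hL hℓ m hm n K a' R hk1 hsize hM8 hR2)).Reg335 c35 α₀ (cfgV1OfT3 U₀) ∧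
          (bgT3 (memberIdx ℓ hL hℓ m hm n K a' R hk1 hsize hM8 hR2)).Reg336 c35 α₀ (cfgV1OfT3 U₀))
    {X Y : ∀ i : KIdx 2 ℓ hd3 hL 1 1, (bgT3 i).Cfg → Type} [∀ i U, SeminormedAddCommGroup (X i U)] [∀ i U, SeminormedAddCommGroup (Y i U)]
    (Gop : ∀ (i : KIdx 2 ℓ hd3 hL 1 1) (U : (bgT3 i).Cfg), X i U → Y i U) (ι : ∀ (i : KIdx 2 ℓ hd3 hL 1 1) (U : (bgT3 i).Cfg), X i U → (geo9K i).Loc)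
    (hw : ∀ (i : KIdx 2 ℓ hd3 hL 1 1) (U : (bgT3 i).Cfg) (f : X i U), (geo9K i).wNorm (-3) (ι i U f) ≤ ‖f‖)
    (hglob : ∀ (i : KIdx 2 ℓ hd3 hL 1 1) (U : (bgT3 i).Cfg) (f : X i U), ‖Gop i U f‖ ≤ max ((GG i).glob 0 U (ι i U f) (-3)) ((GG i).glob 1 U (ι i U f) (-3))) :
    ∃ M₄ a₀ B₀ : ℝ, 0 < M₄ ∧ 0 < a₀ ∧ 0 < B₀ ∧
      ∀ (hℓ : 4 ≤ ℓ) (m : ℕ) (hm : 1 ≤ m) (n K a' R : ℕ) (hk1 : 1 ≤ K - n) (hsize : a' + 3 ≤ m + n) (hM8 : 8 ≤ (ℓ + 1) ^ a') (hR2 : 2 * (ℓ + 1) ^ 2 ≤ R),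
        M₄ ≤ ((ℓ + 1 : ℕ) : ℝ) * (((ℓ + 1) ^ a' : ℕ) : ℝ) →
        ∀ (e : ℝ) (U₀ : GaugeField (PV 2 ℓ m K hd3 hL) 0 (Matrix.specialUnitaryGroup (Fin 2) ℂ)),
          RegPr (⟨ℓ + 1, hL, m, hm⟩ : T3Family) n K e U₀ → e ≤ a₀ / (((ℓ + 1 : ℕ) : ℝ) * (((ℓ + 1) ^ a' : ℕ) : ℝ)) →
            ∀ f : X (memberIdx ℓ hL hℓ m hm n K a' R hk1 hsize hM8 hR2) (cfgV1OfT3 U₀),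
              ‖Gop (memberIdx ℓ hL hℓ m hm n K a' R hk1 hsize hM8 hR2) (cfgV1OfT3 U₀) f‖ ≤ B₀ * ‖f‖ := by
  obtain ⟨M₄, a₀, B₀, hM₄, ha₀, hB₀, h⟩ := normG_of_thm313Printed h313 Gop ι hw hglob
  obtain ⟨a₅, ha₅, hrow⟩ := hCTS
  exact ⟨M₄, min a₀ a₅, B₀, hM₄, lt_min ha₀ ha₅, hB₀, fun hℓ m hm n K a' R hk1 hsize hM8 hR2 hM e U₀ hreg he f =>
    row_of_classBound_of_regPrTransfer Gop ha₀ ha₅ h hrow hℓ m hm n K a' R hk1 hsize hM8 hR2 hM e U₀ hreg he f⟩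

/-- ★ **THE DISPLAYED `norm_H₁`∕`norm_H` ROW FROM `Thm312Printed` ∧ (BG-336)′ ∧ THE PIN** — ★w1-20520's `normH₁_row_of_t312_classTransfer` with `hCT` replaced by the ∃-shape
`hCTS`; conclusion VERBATIM (selected kernel `Hsel i ∈ {Hk i, H₁k i}`, so it serves both the `norm_H₁` and the `norm_H` readings).
[cite: Balaban1985Variational, (103) p.293, (14) p.280; Balaban1985BackgroundPropagators, Thm 3.12 pp.421-423, (3.133) p.422; Balaban1985RegularSpaces, (1.33) p.82, Prop. 6 p.99] -/
theorem normH₁_row_of_t312_classTransferS [∀ i : KIdx 2 ℓ hd3 hL 1 1, Fintype (geo9K i).Site]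
    (h312 : B9.Thm312Printed (2 + 1) c35 geo9K bgT3 GD G₁ Hk H₁k HasRWExp HasRWExpH PosDefK)
    (hCTS : ∃ a₅ : ℝ, 0 < a₅ ∧ ∀ (hℓ : 4 ≤ ℓ) (m : ℕ) (hm : 1 ≤ m) (n K a' R : ℕ) (hk1 : 1 ≤ K - n) (hsize : a' + 3 ≤ m + n) (hM8 : 8 ≤ (ℓ + 1) ^ a')
      (hR2 : 2 * (ℓ + 1) ^ 2 ≤ R) (α₀ : ℝ), 0 < α₀ → ((ℓ + 1 : ℕ) : ℝ) * (((ℓ + 1) ^ a' : ℕ) : ℝ) * α₀ ≤ a₅ →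
      ∀ U₀ : GaugeField (PV 2 ℓ m K hd3 hL) 0 (Matrix.specialUnitaryGroup (Fin 2) ℂ), RegPr (⟨ℓ + 1, hL, m, hm⟩ : T3Family) n K α₀ U₀ →
        (bgT3 (memberIdx ℓ hL hℓ m hm n K a' R hk1 hsize hM8 hR2)).Reg335 c35 α₀ (cfgV1OfT3 U₀) ∧
          (bgT3 (memberIdx ℓ hL hℓ m hm n K a' R hk1 hsize hM8 hR2)).Reg336 c35 α₀ (cfgV1OfT3 U₀))
    (Hsel : ∀ i : KIdx 2 ℓ hd3 hL 1 1, B9.HKernel (geo9K i) (bgT3 i)) (hmem : ∀ i, Hsel i = Hk i ∨ Hsel i = H₁k i)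
    {X Y : ∀ i : KIdx 2 ℓ hd3 hL 1 1, (bgT3 i).Cfg → Type} [∀ i U, SeminormedAddCommGroup (X i U)] [∀ i U, SeminormedAddCommGroup (Y i U)]
    (Hop : ∀ (i : KIdx 2 ℓ hd3 hL 1 1) (U : (bgT3 i).Cfg), X i U → Y i U) (s : ℝ)
    (hls : ∀ (i : KIdx 2 ℓ hd3 hL 1 1) (y : (geo9K i).Site), (geo9K i).len y ^ s ≤ 1)
    (hpin : ∀ (i : KIdx 2 ℓ hd3 hL 1 1) (U : (bgT3 i).Cfg) (b : X i U) (c : ℝ), 0 ≤ c →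
      (∀ (n : Fin 2) (y : (geo9K i).Site),
          (geo9K i).len y ^ ((n : ℝ) + s) * (∑ y' : (geo9K i).Site, (Hsel i).e n U y y' * (geo9K i).len y' ^ ((2 + 1 : ℕ) : ℝ)) * ‖b‖ ≤ c) →
        ‖Hop i U b‖ ≤ c) :
    ∃ M₄ a₀ B₀ : ℝ, 0 < M₄ ∧ 0 < a₀ ∧ 0 < B₀ ∧
      ∀ (hℓ : 4 ≤ ℓ) (m : ℕ) (hm : 1 ≤ m) (n K a' R : ℕ) (hk1 : 1 ≤ K - n) (hsize : a' + 3 ≤ m + n) (hM8 : 8 ≤ (ℓ + 1) ^ a') (hR2 : 2 * (ℓ + 1) ^ 2 ≤ R),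
        M₄ ≤ ((ℓ + 1 : ℕ) : ℝ) * (((ℓ + 1) ^ a' : ℕ) : ℝ) →
        ∀ (e : ℝ) (U₀ : GaugeField (PV 2 ℓ m K hd3 hL) 0 (Matrix.specialUnitaryGroup (Fin 2) ℂ)),
          RegPr (⟨ℓ + 1, hL, m, hm⟩ : T3Family) n K e U₀ → e ≤ a₀ / (((ℓ + 1 : ℕ) : ℝ) * (((ℓ + 1) ^ a' : ℕ) : ℝ)) →
            ∀ b : X (memberIdx ℓ hL hℓ m hm n K a' R hk1 hsize hM8 hR2) (cfgV1OfT3 U₀),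
              ‖Hop (memberIdx ℓ hL hℓ m hm n K a' R hk1 hsize hM8 hR2) (cfgV1OfT3 U₀) b‖ ≤ B₀ * ‖b‖ := by
  obtain ⟨M₄, a₀, B₀, hM₄, ha₀, hB₀, h⟩ :=
    normH_of_thm312Printed h312 rowSum261_geo9K (fun i => (geoOK_geo9K i).lenpos) Hsel hmem Hop s hls hpin
  obtain ⟨a₅, ha₅, hrow⟩ := hCTS
  exact ⟨M₄, min a₀ a₅, B₀, hM₄, lt_min ha₀ ha₅, hB₀, fun hℓ m hm n K a' R hk1 hsize hM8 hR2 hM e U₀ hreg he b =>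
    row_of_classBound_of_regPrTransfer Hop ha₀ ha₅ h hrow hℓ m hm n K a' R hk1 hsize hM8 hR2 hM e U₀ hreg he b⟩

end Shape

/-! ## §3 The class-transfer input DISCHARGED: the rows from the leaves + pins at every leaf constant above the Proposition-6 threshold -/

section Discharged

variable {GG : ∀ i : KIdx 2 ℓ hd3 hL 1 1, B9.KernelFamily (geo9K i) (bgT3 i)}
  {GD G₁ : ∀ i : KIdx 2 ℓ hd3 hL 1 1, B9.KernelFamily (geo9K i) (bgT3 i)} {Hk H₁k : ∀ i : KIdx 2 ℓ hd3 hL 1 1, B9.HKernel (geo9K i) (bgT3 i)}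
  {HasRWExp : ∀ i : KIdx 2 ℓ hd3 hL 1 1, B9.KernelFamily (geo9K i) (bgT3 i) → (bgT3 i).Cfg → ℝ → Prop}
  {HasRWExpH : ∀ i : KIdx 2 ℓ hd3 hL 1 1, B9.HKernel (geo9K i) (bgT3 i) → (bgT3 i).Cfg → ℝ → Prop}
  {PosDefK : ∀ i : KIdx 2 ℓ hd3 hL 1 1, B9.KernelFamily (geo9K i) (bgT3 i) → (bgT3 i).Cfg → Prop}

/-- ★★ **THE DISPLAYED `norm_G` ROW FROM THE THEOREM-3.13 LEAF AND THE TWO (3.47) PINS ALONE** — the class-transfer input ((1.33) second clause) SUPPLIED by [B8] Prop. 6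
(`reg335_reg336_T3_of_regPr`): for odd `L = ℓ + 1 ≥ 5` there is a threshold `c35₀ > 0` (print's «O(1)» of (3.35) as produced by Proposition 6 at the T³ class) such that for
every leaf constant `c35 ≥ c35₀`, `Thm313Printed c35 …` and the pins give ★w1-20520's displayed row verbatim.
[cite: Balaban1985Variational, (117) p.295; Balaban1985BackgroundPropagators, Thm 3.13 p.426, (3.47) p.398, (3.35)–(3.36) p.396; Balaban1985RegularSpaces, (1.33) p.82, Prop. 6 (1.135)–(1.138) p.99] -/
theorem normG_row_of_t313_P6 (hℓ4 : 4 ≤ ℓ) :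
    ∃ c35₀ : ℝ, 0 < c35₀ ∧ ∀ c35 : ℝ, c35₀ ≤ c35 →
      B9.Thm313Printed c35 geo9K bgT3 GG HasRWExp PosDefK →
      ∀ {X Y : ∀ i : KIdx 2 ℓ hd3 hL 1 1, (bgT3 i).Cfg → Type} [∀ i U, SeminormedAddCommGroup (X i U)] [∀ i U, SeminormedAddCommGroup (Y i U)]
        (Gop : ∀ (i : KIdx 2 ℓ hd3 hL 1 1) (U : (bgT3 i).Cfg), X i U → Y i U) (ι : ∀ (i : KIdx 2 ℓ hd3 hL 1 1) (U : (bgT3 i).Cfg), X i U → (geo9K i).Loc),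
        (∀ (i : KIdx 2 ℓ hd3 hL 1 1) (U : (bgT3 i).Cfg) (f : X i U), (geo9K i).wNorm (-3) (ι i U f) ≤ ‖f‖) →
        (∀ (i : KIdx 2 ℓ hd3 hL 1 1) (U : (bgT3 i).Cfg) (f : X i U), ‖Gop i U f‖ ≤ max ((GG i).glob 0 U (ι i U f) (-3)) ((GG i).glob 1 U (ι i U f) (-3))) →
        ∃ M₄ a₀ B₀ : ℝ, 0 < M₄ ∧ 0 < a₀ ∧ 0 < B₀ ∧
          ∀ (hℓ : 4 ≤ ℓ) (m : ℕ) (hm : 1 ≤ m) (n K a' R : ℕ) (hk1 : 1 ≤ K - n) (hsize : a' + 3 ≤ m + n) (hM8 : 8 ≤ (ℓ + 1) ^ a')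
            (hR2 : 2 * (ℓ + 1) ^ 2 ≤ R), M₄ ≤ ((ℓ + 1 : ℕ) : ℝ) * (((ℓ + 1) ^ a' : ℕ) : ℝ) →
            ∀ (e : ℝ) (U₀ : GaugeField (PV 2 ℓ m K hd3 hL) 0 (Matrix.specialUnitaryGroup (Fin 2) ℂ)),
              RegPr (⟨ℓ + 1, hL, m, hm⟩ : T3Family) n K e U₀ → e ≤ a₀ / (((ℓ + 1 : ℕ) : ℝ) * (((ℓ + 1) ^ a' : ℕ) : ℝ)) →
                ∀ f : X (memberIdx ℓ hL hℓ m hm n K a' R hk1 hsize hM8 hR2) (cfgV1OfT3 U₀),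
                  ‖Gop (memberIdx ℓ hL hℓ m hm n K a' R hk1 hsize hM8 hR2) (cfgV1OfT3 U₀) f‖ ≤ B₀ * ‖f‖ := by
  obtain ⟨c35₀, a₅, hc35₀, ha₅, hP6⟩ := reg335_reg336_T3_of_regPr ℓ hL hℓ4
  refine ⟨c35₀, hc35₀, fun c35 hc h313 X Y _ _ Gop ι hw hglob => ?_⟩
  exact normG_row_of_t313_classTransferS h313 ⟨a₅, ha₅, fun hℓ m hm n K a' R hk1 hsize hM8 hR2 α₀ hα₀ hMα U₀ hreg =>
    hP6 hℓ m hm n K a' R hk1 hsize hM8 hR2 α₀ hα₀ hMα U₀ hreg c35 hc⟩ Gop ι hw hglob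

/-- ★★ **THE DISPLAYED `norm_H₁`∕`norm_H` ROW FROM THE THEOREM-3.12 LEAF AND THE PIN ALONE** — the class-transfer input SUPPLIED by [B8] Prop. 6: for odd `L = ℓ + 1 ≥ 5` there
is `c35₀ > 0` such that for every leaf constant `c35 ≥ c35₀`, `Thm312Printed (2+1) c35 …`, a selected kernel `Hsel i ∈ {Hk i, H₁k i}` and the pin give ★w1-20520's displayed row
verbatim. [cite: Balaban1985Variational, (103) p.293; Balaban1985BackgroundPropagators, Thm 3.12 pp.421-423, (3.133) p.422, (3.35)–(3.36) p.396; Balaban1985RegularSpaces, (1.33) p.82, Prop. 6 (1.135)–(1.138) p.99] -/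
theorem normH₁_row_of_t312_P6 [∀ i : KIdx 2 ℓ hd3 hL 1 1, Fintype (geo9K i).Site] (hℓ4 : 4 ≤ ℓ) :
    ∃ c35₀ : ℝ, 0 < c35₀ ∧ ∀ c35 : ℝ, c35₀ ≤ c35 →
      B9.Thm312Printed (2 + 1) c35 geo9K bgT3 GD G₁ Hk H₁k HasRWExp HasRWExpH PosDefK →
      ∀ (Hsel : ∀ i : KIdx 2 ℓ hd3 hL 1 1, B9.HKernel (geo9K i) (bgT3 i)), (∀ i, Hsel i = Hk i ∨ Hsel i = H₁k i) →
      ∀ {X Y : ∀ i : KIdx 2 ℓ hd3 hL 1 1, (bgT3 i).Cfg → Type} [∀ i U, SeminormedAddCommGroup (X i U)] [∀ i U, SeminormedAddCommGroup (Y i U)]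
        (Hop : ∀ (i : KIdx 2 ℓ hd3 hL 1 1) (U : (bgT3 i).Cfg), X i U → Y i U) (s : ℝ),
        (∀ (i : KIdx 2 ℓ hd3 hL 1 1) (y : (geo9K i).Site), (geo9K i).len y ^ s ≤ 1) →
        (∀ (i : KIdx 2 ℓ hd3 hL 1 1) (U : (bgT3 i).Cfg) (b : X i U) (c : ℝ), 0 ≤ c →
          (∀ (n : Fin 2) (y : (geo9K i).Site),
              (geo9K i).len y ^ ((n : ℝ) + s) * (∑ y' : (geo9K i).Site, (Hsel i).e n U y y' * (geo9K i).len y' ^ ((2 + 1 : ℕ) : ℝ)) * ‖b‖ ≤ c) →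
            ‖Hop i U b‖ ≤ c) →
        ∃ M₄ a₀ B₀ : ℝ, 0 < M₄ ∧ 0 < a₀ ∧ 0 < B₀ ∧
          ∀ (hℓ : 4 ≤ ℓ) (m : ℕ) (hm : 1 ≤ m) (n K a' R : ℕ) (hk1 : 1 ≤ K - n) (hsize : a' + 3 ≤ m + n) (hM8 : 8 ≤ (ℓ + 1) ^ a')
            (hR2 : 2 * (ℓ + 1) ^ 2 ≤ R), M₄ ≤ ((ℓ + 1 : ℕ) : ℝ) * (((ℓ + 1) ^ a' : ℕ) : ℝ) →
            ∀ (e : ℝ) (U₀ : GaugeField (PV 2 ℓ m K hd3 hL) 0 (Matrix.specialUnitaryGroup (Fin 2) ℂ)),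
              RegPr (⟨ℓ + 1, hL, m, hm⟩ : T3Family) n K e U₀ → e ≤ a₀ / (((ℓ + 1 : ℕ) : ℝ) * (((ℓ + 1) ^ a' : ℕ) : ℝ)) →
                ∀ b : X (memberIdx ℓ hL hℓ m hm n K a' R hk1 hsize hM8 hR2) (cfgV1OfT3 U₀),
                  ‖Hop (memberIdx ℓ hL hℓ m hm n K a' R hk1 hsize hM8 hR2) (cfgV1OfT3 U₀) b‖ ≤ B₀ * ‖b‖ := by
  obtain ⟨c35₀, a₅, hc35₀, ha₅, hP6⟩ := reg335_reg336_T3_of_regPr ℓ hL hℓ4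
  refine ⟨c35₀, hc35₀, fun c35 hc h312 Hsel hmem X Y _ _ Hop s hls hpin => ?_⟩
  exact normH₁_row_of_t312_classTransferS h312 ⟨a₅, ha₅, fun hℓ m hm n K a' R hk1 hsize hM8 hR2 α₀ hα₀ hMα U₀ hreg =>
    hP6 hℓ m hm n K a' R hk1 hsize hM8 hR2 α₀ hα₀ hMα U₀ hreg c35 hc⟩ Hsel hmem Hop s hls hpin

end Discharged

end Summit.QuantumFields.YangMills.Theorems.Prop7SectET3ClassTransferRows

end
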